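import Mathlib
import HarnessLib
import Summits.KontsevichZagierPeriods.KontsevichZagierPeriods.Theorems.SoloInformedKubertLevel66

/-!
# SoloInformed — Gauss's multiplication formula of index 5 is NOT a composite of two-term Beta
relations: the TWO-TERM LATTICE `V_lin(25)` and its odd level-5 functional (kernel certificate)

Context (paper/main.md §7 (c6), solo-informed). The FACTORWISE mechanism of `SoloInformedKubertLevel66`
derives a `Γ`-monomial identity between Dirichlet simplex integrals from (E2) Dirichlet refactorisations
`B(x,y)B(x+y,z) = B(y,z)B(y+z,x)` (explicit changes of variables; they do not change the exponent vector)
and (E1) ℚ̄-linear relations between TWO Beta values `B(a/N,b/N) = β·B(c/N,d/N)` of one level — each a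
`Rung₂` instance, decided granted Huber–Wüstholz by `soloInformed_volumeRung_le_two`. Such a relation is
true iff the two Beta symbols have the same CM type `τ_{a,b}(t) = (⟨ta⟩+⟨tb⟩-⟨t(a+b)⟩)/N` on the units
`t` (Koblitz–Ogus / Wolfart–Wüstholz). Hence a necessary condition for a factorwise derivation of
`u = α v'` at level `N` is that the exponent vector `vec(u) - vec(v')` lie in the TWO-TERM LATTICE
`V_lin(N) = ℤ⟨vec B(a,b) - vec B(c,d) : τ_{a,b} = τ_{c,d}⟩`.

Gauss's multiplication formula of index `5` at `x = 1/25`,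
`Γ(1/25)Γ(6/25)Γ(11/25)Γ(16/25)Γ(21/25) = (2π)² 5^{3/10} Γ(1/5)`, is — after three reflections — the
`Rung₃` identity `B(1/25,6/25,11/25) = α · B(4/25,5/25,9/25)` between two `2`-simplex Dirichlet integrals
(Aoki's `5`-standard character `σ_{5,1} = (1,6,11,16,21,20)` of the Fermat fourfold `X⁴₂₅`; STANDARD:
`soloInformed_gauss5_mem_stdLattice`). We certify that its exponent vector is NOT in `V_lin(25)`:
the odd level-`5` Kubert functional on the subgroup `5ℤ/25`,
`ω(v) = -3·v(5) - v(10) + v(15) + 3·v(20)` (`= Σ_{k'} (2k'-5) v(5k')`), vanishes on every two-term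
generator (`soloInformed_omega25_twoTerm`) and takes the value `3` on the Gauss vector. The vanishing is
proved STRUCTURALLY, not by enumerating the `25⁴` pairs: `ω(vec B(a,b))` is an explicit function `G` of
the coset sums `n_c = Σ_{t ≡ c (5)} τ_{a,b}(t)` of the CM type (`soloInformed_omega25_betaVec`, 600
symbols by `decide`), namely `0` if all `n_c ∈ {2,3}` and `2 n₁ - 5` otherwise.

So: duplication (`B(x,x) = 2^{1-2x} B(x,1/2)`, an explicit substitution `u = 4t(1-t)`) and triplication
(a two-term relation, decided granted H–W; `work/s69/gauss_mult.out`) are inside the curve-level calculus,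
but QUINTUPLICATION is not: inside the Beta-binomial calculus granted Huber–Wüstholz it is underivable at
level `25` (this file) and at levels `50, 75, 100, 150` (`work/s69/gauss_mult.out`, same functional
family); its only known route to a Kontsevich–Zagier derivation is THEOREM A with `n = 4` through Aoki's
explicit codimension-`2` cycle on `X⁴₂₅` (J. Math. Soc. Japan 39 (1987), Thm 2-1). The same functionals
(`ω_{p,s}` on `pℤ/p²`, `p = 5, 7`; on `5ℤ/35`, `7ℤ/35`) cut out `V_lin ⊗ ℚ` exactly at `N = 25, 35, 49`
and detect `σ_{7,1}` at `49` and the Kubert–Das class `k₃₅` (`work/s69/ann_odd.py`). Everything is `decide`.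
-/

namespace Summit.KontsevichZagierPeriods.KontsevichZagierPeriods.Theorems

/-! ## CM types of Beta symbols at level 25 and the two-term lattice -/

/-- The twenty units of `ℤ/25`, in increasing order. -/
def soloInformedUnits25 : List (ZMod 25) :=
  [1, 2, 3, 4, 6, 7, 8, 9, 11, 12, 13, 14, 16, 17, 18, 19, 21, 22, 23, 24]

/-- The CM type of the Beta symbol `B(a/25,b/25)`: the list of carries
`(⟨ta⟩ + ⟨tb⟩ - ⟨t(a+b)⟩)/25 ∈ {0,1}` over the units `t` (order of `soloInformedUnits25`). Two Beta values
of level `25` are ℚ̄-proportional iff their CM types agree (Koblitz–Ogus, Wolfart–Wüstholz). -/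
def soloInformedTau25 (a b : ZMod 25) : List ℕ :=
  soloInformedUnits25.map fun t => ((t * a).val + (t * b).val - (t * (a + b)).val) / 25

/-- Generators of the two-term lattice: `vec B(a,b) - vec B(c,d)` for admissible symbols (`a, b, a+b ≠ 0`:
no `Γ`-value at an integer) of equal CM type (the exponent vectors of the true ℚ̄-linear relations between
two Beta values of level `25`). -/
def soloInformedTwoTermGen25 : Set (ZMod 25 → ℤ) :=
  {v | ∃ a b c d : ZMod 25, (a ≠ 0 ∧ b ≠ 0 ∧ a + b ≠ 0) ∧ (c ≠ 0 ∧ d ≠ 0 ∧ c + d ≠ 0) ∧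
      soloInformedTau25 a b = soloInformedTau25 c d ∧
      v = soloInformedBetaVec 25 a b - soloInformedBetaVec 25 c d}

/-- The two-term lattice `V_lin(25)`. A factorwise derivation (E1/E2 moves) changes the exponent vector of a
state only by elements of this lattice. -/
def soloInformedTwoTermLattice25 : Submodule ℤ (ZMod 25 → ℤ) :=
  Submodule.span ℤ soloInformedTwoTermGen25

/-! ## The odd level-5 functional on the subgroup `5ℤ/25` -/

/-- `ω(v) = Σ_{k'=1}^{4} (⟨k'⟩₅ - ⟨-k'⟩₅)·v(5k') = -3 v(5) - v(10) + v(15) + 3 v(20)`. -/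
def soloInformedOmega25 : (ZMod 25 → ℤ) →ₗ[ℤ] ℤ where
  toFun v := -3 * v 5 - v 10 + v 15 + 3 * v 20
  map_add' u w := by simp only [Pi.add_apply]; ring
  map_smul' c u := by simp only [Pi.smul_apply, smul_eq_mul, RingHom.id_apply]; ring

/-- Evaluation of `ω`. -/
theorem soloInformedOmega25_apply (v : ZMod 25 → ℤ) :
    soloInformedOmega25 v = -3 * v 5 - v 10 + v 15 + 3 * v 20 := rfl

/-- Coset sums of a CM type: `n_c = Σ_{t ≡ c (mod 5)} τ(t)`, read off the list positions of
`soloInformedUnits25` (`c = 1`: positions of `1,6,11,16,21`, etc.). -/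
def soloInformedCosetSum25 (l : List ℕ) (c : ℕ) : ℕ :=
  ((List.range 20).filter fun i => (soloInformedUnits25.getD i 0).val % 5 = c).foldr
    (fun i s => l.getD i 0 + s) 0

/-- The structural formula: `G(τ) = 0` if every coset sum is `2` or `3` (no entry of the symbol divisible by
`5`), and `2 n₁ - 5` otherwise. -/
def soloInformedG25 (l : List ℕ) : ℤ :=
  if (soloInformedCosetSum25 l 1 = 2 ∨ soloInformedCosetSum25 l 1 = 3) ∧
      (soloInformedCosetSum25 l 2 = 2 ∨ soloInformedCosetSum25 l 2 = 3) ∧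
      (soloInformedCosetSum25 l 3 = 2 ∨ soloInformedCosetSum25 l 3 = 3) ∧
      (soloInformedCosetSum25 l 4 = 2 ∨ soloInformedCosetSum25 l 4 = 3)
  then 0 else 2 * (soloInformedCosetSum25 l 1 : ℤ) - 5

/-- KEY LEMMA: on every admissible Beta symbol, `ω` is the function `G` of the CM type. -/
theorem soloInformed_omega25_betaVec : ∀ a b : ZMod 25, (a ≠ 0 ∧ b ≠ 0 ∧ a + b ≠ 0) →
    soloInformedOmega25 (soloInformedBetaVec 25 a b) = soloInformedG25 (soloInformedTau25 a b) := by
  intro a b h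
  rw [soloInformedOmega25_apply]
  revert h; revert b; revert a
  decide

/-- Hence `ω` vanishes on every two-term generator … -/
theorem soloInformed_omega25_gen : ∀ v ∈ soloInformedTwoTermGen25, soloInformedOmega25 v = 0 := by
  rintro v ⟨a, b, c, d, hab, hcd, htau, rfl⟩
  rw [map_sub, soloInformed_omega25_betaVec a b hab, soloInformed_omega25_betaVec c d hcd, htau, sub_self]

/-- … and on the whole two-term lattice `V_lin(25)`. -/
theorem soloInformed_omega25_twoTerm : ∀ v ∈ soloInformedTwoTermLattice25, soloInformedOmega25 v = 0 := by
  intro v hv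
  induction hv using Submodule.span_induction with
  | mem v h => exact soloInformed_omega25_gen v h
  | zero => simp
  | add u w _ _ hu hw => rw [map_add, hu, hw, add_zero]
  | smul c u _ hu => rw [map_smul, hu, smul_zero]

/-! ## The Gauss quintuplication vector -/

/-- Exponent vector of `B(1/25,6/25,11/25) / B(9/25,4/25,5/25)` in the caterpillar factorisations
`B(1,6)·B(7,11)` and `B(9,4)·B(13,5)` (numerators over `25`; the common `Γ(18/25)` cancels):
`e₁ + e₆ + e₁₁ - e₄ - e₅ - e₉`. -/
def soloInformedGauss5 : ZMod 25 → ℤ :=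
  soloInformedBetaVec 25 1 6 + soloInformedBetaVec 25 7 11 -
    (soloInformedBetaVec 25 9 4 + soloInformedBetaVec 25 13 5)

/-- The Gauss vector explicitly: `e₁ + e₆ + e₁₁ - e₄ - e₅ - e₉`. -/
theorem soloInformed_gauss5_eq : soloInformedGauss5 =
    fun x => (if x = 1 ∨ x = 6 ∨ x = 11 then 1 else 0) - (if x = 4 ∨ x = 5 ∨ x = 9 then 1 else 0) := by
  funext x; revert x; decide

/-- It is Aoki's `5`-standard sextuple `σ_{5,1} = (1,6,11,16,21,20)` minus three reflection pairs, and
`σ_{5,1} = D(5,1) + R₅` where `D(5,1) = 𝟙_{x ≡ 1 (5)} - e₅` is the distribution (Gauss multiplication)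
vector: so `soloInformedGauss5 = D(5,1) - R₄ - R₉`. -/
theorem soloInformed_gauss5_sigma :
    (soloInformedGauss5 = (fun x => if x = 1 ∨ x = 6 ∨ x = 11 ∨ x = 16 ∨ x = 21 ∨ x = 20 then 1 else 0)
        - (soloInformedReflVec 25 4 + soloInformedReflVec 25 5 + soloInformedReflVec 25 9)) ∧
    soloInformedGauss5 = soloInformedDistVec 25 5 1 - soloInformedReflVec 25 4 - soloInformedReflVec 25 9 := by
  constructor <;> (funext x; revert x; decide)

/-- The Gauss vector is STANDARD (`∈ L₂₅`): certificate `D(5,1) - R₄ - R₉`. -/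
theorem soloInformed_gauss5_mem_stdLattice : soloInformedGauss5 ∈ soloInformedStdLattice 25 := by
  have h : soloInformedGauss5 = soloInformedCombo 25 [(1, .inr (5, 1)), (-1, .inl 4), (-1, .inl 9)] := by
    funext x; revert x; decide
  rw [h]
  exact soloInformed_combo_mem 25 _ (by decide)

/-- It is a genuine Hodge (hence true, `Γ(σ_{5,1}) ∈ ℚ̄·π³`) element: `⟨t⟩+⟨6t⟩+⟨11t⟩ ≡ ⟨4t⟩+⟨5t⟩+⟨9t⟩`
with equal sums `18` — for every unit `t` the carries of the two simplex integrals agree in total: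
`Σ_up ⟨t aᵢ⟩ = Σ_down ⟨t bⱼ⟩`. -/
theorem soloInformed_gauss5_hodge : ∀ t ∈ soloInformedUnits25,
    (t * 1).val + (t * 6).val + (t * 11).val = (t * 4).val + (t * 5).val + (t * 9).val := by
  decide

/-- `ω(Gauss vector) = 3`. -/
theorem soloInformed_omega25_gauss5 : soloInformedOmega25 soloInformedGauss5 = 3 := by
  rw [soloInformedOmega25_apply]; decide

/-- MAIN: Gauss's multiplication formula of index `5` (level `25`) is not in the two-term lattice: no
factorwise derivation (Dirichlet refactorisations + ℚ̄-linear relations between two Beta values of level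
`25`) of `B(1/25,6/25,11/25) = α·B(4/25,5/25,9/25)` exists. -/
theorem soloInformed_gauss5_not_twoTerm : soloInformedGauss5 ∉ soloInformedTwoTermLattice25 := by
  intro h
  have h0 := soloInformed_omega25_twoTerm _ h
  rw [soloInformed_omega25_gauss5] at h0
  exact absurd h0 (by decide)

/-- The two-term lattice is far from trivial — two sample generators on which `ω` vanishes, as it must:
`B(1/25,1/25) = 2cos(π/25)·B(1/25,23/25)` (reflection type) and `B(5/25,5/25) ∼ B(5/25,15/25)`
(level-`5` duplication/reflection type, supported on the subgroup `5ℤ/25` where `ω` lives). -/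
theorem soloInformed_twoTerm_example :
    (soloInformedTau25 1 1 = soloInformedTau25 1 23 ∧
      soloInformedBetaVec 25 1 1 - soloInformedBetaVec 25 1 23 ∈ soloInformedTwoTermLattice25 ∧
      soloInformedOmega25 (soloInformedBetaVec 25 1 1 - soloInformedBetaVec 25 1 23) = 0) ∧
    (soloInformedTau25 5 5 = soloInformedTau25 5 15 ∧
      soloInformedBetaVec 25 5 5 - soloInformedBetaVec 25 5 15 ∈ soloInformedTwoTermLattice25 ∧
      soloInformedOmega25 (soloInformedBetaVec 25 5 5 - soloInformedBetaVec 25 5 15) = 0) := by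
  refine ⟨⟨by decide, ?_, by rw [soloInformedOmega25_apply]; decide⟩,
    ⟨by decide, ?_, by rw [soloInformedOmega25_apply]; decide⟩⟩
  · exact Submodule.subset_span ⟨1, 1, 1, 23, by decide, by decide, by decide, rfl⟩
  · exact Submodule.subset_span ⟨5, 5, 5, 15, by decide, by decide, by decide, rfl⟩

end Summit.KontsevichZagierPeriods.KontsevichZagierPeriods.Theorems
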